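import Summits.PneNP.PneNP.Theorems.SymmetryBudgetWindowCanoniserSemStep

/-!
# Window canoniser, XVIII: gate semantics of the main computation — ranks, certification, lifting

Route `PneNP/SymmetryBudget`, dichotomy `WindowBarrier` (stmt-PneNP-2145) / `NoHiddenOrder` (stmt-PneNP-14781);
continuation of `…WindowCanoniserSemStep.lean`.  With the final replay state `WCan.finSt L x = rs L x (T n)`:
`rkGE w j` counts the vertices of `W` below `w`; `mtch ch it ↔ WCan.StEq (rs child it) (finSt L)` (the child's
state at `it` is mine: same sets, same lifted order); `thru ch ↔ WCan.thruP` (through my state, unfrozen, and —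
for a candidate — selecting its vertex); `cert ch ↔` child defined, through, `okP`, and reporting a value
(`WCan.NBP`, the `nonbotF` formula); `pcand`/`lcrk` (a candidate's colour ranks through its own rank gates);
`pfx`/`lexLE` (prefix agreement and the lexicographic comparison of lifted value vectors, `WCan.lvec`);
`best`, `ivbit`, `inonbot`.
-/

-- `Summit.PneNP.PneNP.…` duplicates `PneNP` BY DESIGN (single-problem summit, D-0017 layout).
set_option linter.dupNamespace false

noncomputable section

namespace Summit.PneNP.PneNP.Theorems

namespace WCan

open Finset Literature.Computability.Complexity Literature.Computability.Complexity.CGCanon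
  Literature.Combinatorics.SimpleGraph
open scoped Classical

variable {K r n : ℕ}

/-! ### Mathematical side -/

section MathSide

variable (L : RawLab n) (x : Fin (r + n) × Fin (r + n) → Bool)

/-- The final replay state of `L`. -/
abbrev finSt : St n := rs L x (T n)

/-- Two states AGREE: same vertex set, same consumed set, same lifted colour order. -/
def StEq (S S' : St n) : Prop := S.W = S'.W ∧ S.C = S'.C ∧ ∀ u w, S.liftLT u w ↔ S'.liftLT u w

/-- The RANK of `w` in the final state: vertices of `W` of smaller lifted colour. -/
def rankF (w : Fin n) : ℕ := ((finSt L x).W.filter fun w' => (finSt L x).liftLT w' w).card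

end MathSide

variable [NeZero n] {L : Lab K n} {x : Fin (r + n) × Fin (r + n) → Bool} (hn : 2 ≤ n)
include hn

/-- The final state gates hold the final state. -/
theorem corr_fin : Corr L x (tf n) (finSt L.1 x) := by
  have := corr_rs (L := L) (x := x) hn (tf n)
  simpa [Fin.val_last] using this

omit hn in
/-- Appending constant tuples gives a constant tuple. -/
theorem append_const {α : Type*} {a b : ℕ} (c : α) : Fin.append (fun _ : Fin a => c) (fun _ : Fin b => c) = fun _ => c := by
  funext i; induction i using Fin.addCases <;> simp

/-! ### Ranks -/

/-- `rkGE w j` computes `j ≤ rankF w`. -/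
theorem ev_aRkGE (w : Fin n) (j : Fin (n + 1)) : ev x (aRkGE (r := r) L w j) = decide ((j : ℕ) ≤ rankF L.1 x w) := by
  have h := corr_fin (L := L) (x := x) hn
  apply Bool.eq_iff_iff.2
  show Vl K x _ = true ↔ _
  rw [Vl_eq, decide_eq_true_iff]
  show (GateFn.maj (n + n)).2 (fun i => GateDAG.wire x (Vl K x) (cnt n j (fun w' => w1 (n1and [pos (aW L (tf n) w'), pos (aLT L (tf n) w' w)])) i)) = true ↔ _
  rw [maj_cnt_iff x (Nat.lt_succ_iff.1 j.2)]
  have hw : ∀ w', GateDAG.wire x (Vl K x) (w1 (n1and [pos (aW L (tf n) w'), pos (aLT (r := r) L (tf n) w' w)])) = true ↔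
      (w' ∈ (finSt L.1 x).W ∧ (finSt L.1 x).liftLT w' w) := by
    intro w'; rw [wire_w1, Vl_n1and x _ (by simp)]; simp [h.W, h.LT]
  simp only [hw, rankF]
  rw [show (univ.filter fun w' => w' ∈ (finSt L.1 x).W ∧ (finSt L.1 x).liftLT w' w) =
    (finSt L.1 x).W.filter fun w' => (finSt L.1 x).liftLT w' w from by ext; simp]

/-- The rank formula `rkF Lx w j` holds iff `rankF w = j`. -/
theorem Vl_rkF (Lx : Lab K n) (w j : Fin n) : Vl K x (.f1 (rkF (r := r) Lx w j)) = true ↔ rankF Lx.1 x w = j := by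
  rw [rkF, Vl_n1and x _ (by simp)]
  simp only [List.mem_cons, List.not_mem_nil, or_false, forall_eq_or_imp, forall_eq, holds_pos, holds_neg, ev_aRkGE hn,
    Fin.val_castSucc, Fin.val_succ, decide_eq_true_eq, decide_eq_false_iff_not]
  omega

/-! ### Certification -/

/-- THROUGH MY STATE (record form): at some iteration the child's replay state agrees with my final state, is
not frozen, and — for a candidate record (`fl = false`) — selects the vertex of slot `0`. -/
def thruR (L Lc : RawLab n) (x : Fin (r + n) × Fin (r + n) → Bool) (fl : Bool) (v : Fin n) : Prop :=
  ∃ it < T n, StEq (rs Lc x it) (finSt L x) ∧ ¬ frzP Lc (rs Lc x it) ∧ (fl = false → v ∈ selSet Lc (rs Lc x it))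

/-- The group of `Lc` REPORTS A VALUE (the `nonbotF` formula, read at ambient vertex `z`). -/
def NBP (Lc : Lab K n) (x : Fin (r + n) × Fin (r + n) → Bool) (z : Fin n) : Prop := Vl K x (.f2 (nonbotF (r := r) Lc z)) = true

/-- `mtch` on a record: the child's state at `P.it` agrees with my final state. -/
theorem ev_mtch (P : Prm r n) : ev x (.lab L .mtch P) = decide (∃ Lc, chLab L P = some Lc ∧ StEq (rs Lc.1 x P.it) (finSt L.1 x)) := by
  have hT := corr_fin (L := L) (x := x) hn
  apply Bool.eq_iff_iff.2
  show Vl K x _ = true ↔ _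
  rw [Vl_eq, decide_eq_true_iff]
  show (GateFn.and (n + n + n * n)).2 (fun i => GateDAG.wire x (Vl K x) (Kind.argsM L .mtch P i)) = true ↔ _
  simp only [GateFn.and, decide_eq_true_iff, Kind.argsM]
  rcases hc : chLab L P with _ | Lc
  · simp only [append_const]
    constructor
    · intro hall
      have := hall ⟨0, by have := NeZero.one_le (n := n); nlinarith⟩
      simp at this
    · rintro ⟨Lc, hLc, -⟩; cases hLc
  · have hC := corr_rs (L := Lc) (x := x) hn P.it
    rw [Fin.forall_fin_add, Fin.forall_fin_add]
    simp only [Fin.append_left, Fin.append_right, wire_w2, Vl_iffF, hC.W, hC.C, hC.LT, hT.W, hT.C, hT.LT, decide_eq_true_eq,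
      finProdFinEquiv_symm_apply]
    constructor
    · rintro ⟨⟨hW, hCC⟩, hL⟩
      refine ⟨Lc, rfl, Finset.ext hW, Finset.ext hCC, fun u w => ?_⟩
      simpa using hL (finProdFinEquiv (u, w))
    · rintro ⟨Lc', hLc, hW, hCC, hL⟩
      cases hLc
      exact ⟨⟨fun v => by rw [hW], fun v => by rw [hCC]⟩, fun i => hL _ _⟩

/-- `thru` on a record. -/
theorem ev_thru (P : Prm r n) : ev x (.lab L .thru P) =
    decide (∃ Lc, chLab L P = some Lc ∧ thruR L.1 Lc.1 x P.fl (P.vs 0)) := by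
  apply Bool.eq_iff_iff.2
  show Vl K x _ = true ↔ _
  rw [Vl_eq, decide_eq_true_iff]
  show (GateFn.or (T n)).2 (fun i => GateDAG.wire x (Vl K x) (Kind.argsM L .thru P i)) = true ↔ _
  simp only [GateFn.or, decide_eq_true_iff, Kind.argsM]
  rcases hc : chLab L P with _ | Lc
  · simp
  · have key : ∀ it : Fin (T n), GateDAG.wire x (Vl K x) (w1 (n1and ([pos (.lab L .mtch { P with it := it.castSucc }), neg (aFrz Lc it.castSucc (P.vs 0))] ++
        (if P.fl then [] else [pos (aSel Lc it.castSucc (P.vs 0))])))) = true ↔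
        (StEq (rs Lc.1 x it) (finSt L.1 x) ∧ ¬ frzP Lc.1 (rs Lc.1 x it) ∧ (P.fl = false → P.vs 0 ∈ selSet Lc.1 (rs Lc.1 x it))) := by
      intro it
      have hCi := corr_rs (L := Lc) (x := x) hn it.castSucc
      have hm : ev x (.lab L .mtch { P with it := it.castSucc }) = true ↔ StEq (rs Lc.1 x it) (finSt L.1 x) := by
        rw [ev_mtch hn, decide_eq_true_iff]
        have : chLab L ({ P with it := it.castSucc } : Prm r n) = chLab L P := rfl
        rw [this, hc]
        simp
      rw [wire_w1, Vl_n1and x _ (by split_ifs <;> simp)]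
      simp only [List.mem_append, List.mem_cons, List.not_mem_nil, or_false, or_imp, forall_and, forall_eq, holds_pos, holds_neg,
        hm, ev_aFrz hCi, Fin.val_castSucc, decide_eq_false_iff_not]
      cases P.fl
      · simp [ev_aSel hCi hn, and_assoc]
      · simp
    simp only [key, thruR]
    constructor
    · rintro ⟨it, hit⟩; exact ⟨Lc, rfl, it, it.2, hit⟩
    · rintro ⟨Lc', hLc, it, hit, hrest⟩; cases hLc; exact ⟨⟨it, hit⟩, hrest⟩

/-- **`cert`** on a record: the child is defined, went through my state, is OK, and reports a value. -/
theorem ev_cert (P : Prm r n) : ev x (.lab L .cert P) =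
    decide (∃ Lc, chLab L P = some Lc ∧ thruR L.1 Lc.1 x P.fl (P.vs 0) ∧ okP Lc.1 x ∧ NBP Lc x (P.vs 0)) := by
  apply Bool.eq_iff_iff.2
  show Vl K x _ = true ↔ _
  rw [Vl_eq, decide_eq_true_iff]
  show (GateFn.and 4).2 (fun i => GateDAG.wire x (Vl K x) (Kind.argsM L .cert P i)) = true ↔ _
  simp only [GateFn.and, decide_eq_true_iff, Kind.argsM]
  rcases hc : chLab L P with _ | Lc
  · constructor
    · intro hall; have := hall 0; simp at this
    · rintro ⟨Lc, hLc, -⟩; cases hLc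
  · have hth : ev x (.lab L .thru { P with it := 0 }) = true ↔ thruR L.1 Lc.1 x P.fl (P.vs 0) := by
      rw [ev_thru hn, decide_eq_true_iff]
      have : chLab L ({ P with it := 0 } : Prm r n) = chLab L P := rfl
      rw [this, hc]; simp
    have hok := ok_iff (L := Lc) (x := x) hn (P.vs 0)
    rw [Fin.forall_fin_succ, Fin.forall_fin_succ, Fin.forall_fin_succ, Fin.forall_fin_one]
    simp only [Fin.isValue, Fin.val_zero, ↓reduceIte, Fin.val_succ, Nat.succ_ne_self, wire_wA, hth, wire_wN,
      Bool.not_eq_true', Nat.reduceEqDiff, wire_w2]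
    simp only [NBP]
    constructor
    · rintro ⟨h1, h2, h3, h4⟩; exact ⟨Lc, rfl, h1, hok.1 ⟨h2, h3⟩, h4⟩
    · rintro ⟨Lc', hLc, h1, h2, h4⟩; cases hLc; exact ⟨h1, (hok.2 h2).1, (hok.2 h2).2, h4⟩

end WCan

end Summit.PneNP.PneNP.Theorems

end
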